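import Literature.NumberTheory.GaloisRepresentations.LiftTorsor
import Literature.NumberTheory.GaloisRepresentations.LiftingObstructionSections
import Literature.NumberTheory.GaloisRepresentations.LiftingObstructionContinuous
import HarnessLib

/-!
# Lifts from split defects: open kernels, and the difference to a framed global lift

Topic `Literature/NumberTheory/GaloisRepresentations`.  Complements to Mazur's criterion
(`LiftingObstruction.liftOfCoboundary`) used when the cone obstruction vanishes
(Böckle 2007, proof of Thm. 7.6):

* `isOpen_ker_liftOfCoboundary` — the lift `σ ↦ (1 − b(σ)) s(ρσ)` built from a LOCALLY CONSTANT
  splitting cochain `b` of the defect of a representation with open kernel has open kernel;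
* `conjHom P ρ = P⁻¹ ρ P`;
* `liftDiff_conjHom_liftOfCoboundary` — **the secondary identity**: for a global lift
  `ρ̃ = (1 − b) s(ρ)` (on `G`), a local lift `ρ̃_v = (1 − b_v) s(ρ')` (on `H`, `ρ'` the framed
  restriction: `N ρ' N⁻¹ = ρ ∘ ι`) and the frame lift `P = s(N)`, the difference cochain of
  `P⁻¹ (ρ̃ ∘ ι) P` and `ρ̃_v` is
  `d(σ) = b_v(σ) + β(σ) − P⁻¹ b(ι σ) P`, `β = sectionDiff s s''` the comparison cochain with the
  framed section `s'' = P⁻¹ s(N · N⁻¹) P`.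

Everything is proved; no named facts.

## References

* B. Mazur, *Deforming Galois representations*, MSRI Publ. 16 (1989), §1.6 Prop. 2.
  [cite: Mazur1989Deforming, §1.6 Prop. 2]
* G. Böckle, *Presentations of universal deformation rings*, LMS LNS 320 (2007), Thm. 7.6.
  [cite: Bockle2007Presentations, Theorem 7.6]
-/

noncomputable section

open Topology Filter

namespace Literature.NumberTheory.GaloisRepresentations

namespace LiftingObstruction

open Matrix

variable {n : Type*} [Fintype n] [DecidableEq n] {A B : Type*} [CommRing A] [CommRing B]
  {φ : B →+* A} (hI : ∀ x ∈ RingHom.ker φ, ∀ y ∈ RingHom.ker φ, x * y = 0)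
  {G : Type*} [Group G] {s : GL n A → GL n B}
  (hs : ∀ g, Matrix.GeneralLinearGroup.map φ (s g) = g)

/-! ## 1. Open kernel of the lift built from a locally constant splitting -/

/-- **The lift built from a locally constant splitting has open kernel.**
[cite: Mazur1989Deforming, §1.6 Prop. 2] -/
theorem isOpen_ker_liftOfCoboundary [TopologicalSpace G] [IsTopologicalGroup G]
    (ρ : G →* GL n A) (hρ : IsOpen ((ρ.ker : Subgroup G) : Set G))
    (b : G → Matrix n n B) (hb : ∀ σ, b σ ∈ kerMatrix φ)
    (hcob : ∀ σ τ, liftDefect s ρ σ τ =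
      (s (ρ σ) : Matrix n n B) * b τ * ((s (ρ σ))⁻¹ : GL n B) - b (σ * τ) + b σ)
    (hblc : IsLocallyConstant b) :
    IsOpen (((liftOfCoboundary hs hI ρ b hb hcob).ker : Subgroup G) : Set G) := by
  refine Subgroup.isOpen_of_mem_nhds _ (g := 1) ?_
  have h1 : {σ : G | b σ = b 1} ∈ 𝓝 (1 : G) := (hblc.isOpen_fiber (b 1)).mem_nhds rfl
  have h2 : ((ρ.ker : Subgroup G) : Set G) ∈ 𝓝 (1 : G) := hρ.mem_nhds (one_mem _)
  filter_upwards [h1, h2] with σ hσb hσρ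
  rw [SetLike.mem_coe, MonoidHom.mem_ker] at hσρ ⊢
  have e0 := liftOfCoboundary_apply hs hI ρ b hb hcob 1
  rw [map_one, map_one] at e0
  have e1 := congrArg (fun g : GL n B => (g : Matrix n n B)) e0
  simp only [Units.val_one, Units.val_mul, val_unitOfKer] at e1
  refine Units.ext ?_
  rw [liftOfCoboundary_apply, Units.val_mul, val_unitOfKer, hσρ, Units.val_one, hσb]
  exact e1.symm

/-! ## 2. Conjugating a homomorphism by a fixed matrix -/

/-- `conjHom P ρ = (σ ↦ P⁻¹ ρ(σ) P)`. [folklore] -/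
def conjHom {H : Type*} [Group H] (P : GL n B) (ρ : H →* GL n B) : H →* GL n B :=
  (MulAut.conj P⁻¹).toMonoidHom.comp ρ

/-- Unfolding `conjHom`. [folklore] -/
@[simp] theorem conjHom_apply {H : Type*} [Group H] (P : GL n B) (ρ : H →* GL n B) (σ : H) :
    conjHom P ρ σ = P⁻¹ * ρ σ * P := by
  simp [conjHom, mul_assoc]

/-- `(P⁻¹ U P) − 1 = P⁻¹ (U − 1) P`. [folklore] -/
theorem val_inv_conj_sub_one (P U : GL n B) :
    ((P⁻¹ * U * P : GL n B) : Matrix n n B) - 1 =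
      ((P⁻¹ : GL n B) : Matrix n n B) * ((U : Matrix n n B) - 1) * (P : Matrix n n B) := by
  have h := val_conj_sub_one' P⁻¹ U
  rw [inv_inv] at h
  exact h

/-! ## 3. The secondary identity -/

/-- **The secondary identity.**  Let `ρ̃ = liftOfCoboundary s ρ b` (global, on `G`),
`ρ̃_v = liftOfCoboundary s ρ' b_v` (local, on `H`), `N ρ' N⁻¹ = ρ ∘ ι`, `P = s(N)`.  Then the
difference cochain of `P⁻¹ (ρ̃ ∘ ι) P` relative to `ρ̃_v` is
`d(σ) = b_v(σ) + β(σ) − P⁻¹ b(ι σ) P` with `β = sectionDiff s (frameSection s N P) ρ'`.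
[cite: Bockle2007Presentations, Theorem 7.6] -/
theorem liftDiff_conjHom_liftOfCoboundary {H : Type*} [Group H] (ρ : G →* GL n A) (ι : H →* G)
    (N : GL n A) (ρ' : H →* GL n A) (hρ' : ∀ σ, N * ρ' σ * N⁻¹ = ρ (ι σ))
    (b : G → Matrix n n B) (hb : ∀ σ, b σ ∈ kerMatrix φ)
    (hcob : ∀ σ τ, liftDefect s ρ σ τ =
      (s (ρ σ) : Matrix n n B) * b τ * ((s (ρ σ))⁻¹ : GL n B) - b (σ * τ) + b σ)
    (bv : H → Matrix n n B) (hbv : ∀ σ, bv σ ∈ kerMatrix φ)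
    (hcobv : ∀ σ τ, liftDefect s ρ' σ τ =
      (s (ρ' σ) : Matrix n n B) * bv τ * ((s (ρ' σ))⁻¹ : GL n B) - bv (σ * τ) + bv σ)
    (σ : H) :
    liftDiff (liftOfCoboundary hs hI ρ' bv hbv hcobv)
        (conjHom (s N) ((liftOfCoboundary hs hI ρ b hb hcob).comp ι)) σ =
      bv σ + sectionDiff s (frameSection s N (s N)) ρ' σ -
        (((s N)⁻¹ : GL n B) : Matrix n n B) * b (ι σ) * (s N : Matrix n n B) := by
  set P : GL n B := s N with hPdef
  have hP : Matrix.GeneralLinearGroup.map φ P = N := hs N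
  -- the three unipotent factors
  have hUb : Matrix.GeneralLinearGroup.map φ (unitOfKer hI (-b (ι σ)) (neg_mem (hb (ι σ)))) = 1 :=
    map_unitOfKer hI _ _
  have hUv : Matrix.GeneralLinearGroup.map φ (unitOfKer hI (-bv σ) (neg_mem (hbv σ))) = 1 :=
    map_unitOfKer hI _ _
  have hs'' : ∀ g, Matrix.GeneralLinearGroup.map φ (frameSection s N P g) = g :=
    map_frameSection hs N P hP
  have hD : Matrix.GeneralLinearGroup.map φ (frameSection s N P (ρ' σ) * (s (ρ' σ))⁻¹) = 1 :=
    map_sectionQuot_eq_one hs hs'' ρ' σ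
  have hX : Matrix.GeneralLinearGroup.map φ
      (P⁻¹ * unitOfKer hI (-b (ι σ)) (neg_mem (hb (ι σ))) * P) = 1 := by
    rw [map_mul, map_mul, map_inv, hUb, mul_one, inv_mul_cancel]
  have hZ : Matrix.GeneralLinearGroup.map φ (unitOfKer hI (-bv σ) (neg_mem (hbv σ)))⁻¹ = 1 := by
    rw [map_inv, hUv, inv_one]
  -- the group identity
  have key : conjHom P ((liftOfCoboundary hs hI ρ b hb hcob).comp ι) σ *
      (liftOfCoboundary hs hI ρ' bv hbv hcobv σ)⁻¹ =
      (P⁻¹ * unitOfKer hI (-b (ι σ)) (neg_mem (hb (ι σ))) * P) *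
        (frameSection s N P (ρ' σ) * (s (ρ' σ))⁻¹) *
        (unitOfKer hI (-bv σ) (neg_mem (hbv σ)))⁻¹ := by
    rw [frameSection_apply_rep ρ ι N ρ' hρ' s P σ, conjHom_apply, MonoidHom.comp_apply,
      liftOfCoboundary_apply, liftOfCoboundary_apply]
    group
  rw [liftDiff, key, val_mul_sub_one hI _ _ (by rw [map_mul, hX, hD, one_mul]) hZ,
    val_mul_sub_one hI _ _ hX hD, val_inv_conj_sub_one, val_inv_eq_of_map_eq_one hI _ hUv,
    val_unitOfKer, val_unitOfKer, ← sectionDiff]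
  simp only [add_sub_cancel_left, Matrix.mul_neg, Matrix.neg_mul]
  abel

/-! ## 4. The framed section in terms of the comparison cochain -/

omit hI in
/-- `s''(g) = (1 + β) s(g)` with `β = s''(g) s(g)⁻¹ − 1` (for the values of two sections at the
same point). [folklore] -/
theorem coe_section_eq_one_add_sectionDiff_mul (s s' : GL n A → GL n B) (ρ : G →* GL n A) (σ : G) :
    (s' (ρ σ) : Matrix n n B) = (1 + sectionDiff s s' ρ σ) * (s (ρ σ) : Matrix n n B) := by
  rw [sectionDiff, add_sub_cancel, ← Units.val_mul, inv_mul_cancel_right]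

end LiftingObstruction

end Literature.NumberTheory.GaloisRepresentations
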